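import Summits.CriticalPhenomena.PercolationContinuityZ3.Theorems.SahiMasterFamilyCBar

/-!
# The CHAIN CRITERION for conjecture (B): certified lower bounds at one-sided nodes (`Below`), the absorbed-root identity, and the
# reduction "chain certificate at every two-sided restriction ⇒ (B) for the pair", every order

Unit `prim-masterthm-p4` (gen 24; crux anchor stmt-CriticalPhenomena-4575, helper work; memo
`run/shared/lean/prim/prim-masterthm/prim-masterthm-p4/P4-GEN24-REPORT.md` §4).  Companion of `…SahiMasterFamilyCBar` (root-summed identity
`(n+1)·P_T = cbarSlack + goodPart`, typed (C̄), and `(C̄) at two-sided + (B♮) at one-sided restrictions ⇒ (B)`).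

WHY.  In the two-theorem skeleton of `…CBar` the one-sided half ("THEOREM B": the edge polynomial of every ONE-SIDED restricted pair — top in
exactly one family — is Bernstein-positive) is itself as hard as (B): on 5 points there are 128 one-sided pairs that defeat every one- and
two-level criterion (P4-GEN22 kit j207043).  The memo's CHAIN CRITERION (★′) removes THEOREM B altogether: at a one-sided node `Q ∈ 𝒱 ∖ 𝒰` with
an ADMISSIBLE root `z` (in no member of `𝒰`; it exists because `𝒰|_Q` is union-closed and misses `Q`) the ABSORBED-ROOT IDENTITY
  `P_Q = (1−w)·[ W^{(z)} + Σ_{B ∋ z, B ∉ 𝒱} (|B|−1)!·P_{Q∖B} ]`      (`phiSet_mix_eq_absorbed`; the algebra of `UCBernsteinRootable.bpos_step_right`)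
has no top term, so `P_Q ≥_B (1−w)·Σ_B (|B|−1)!·ℓ_B` for ANY certified lower bounds `ℓ_B ≤_B P_{Q∖B}` of the children (drop `W ≥_B 0`): bad children
exactly (`ℓ = P = −N`), two-sided children `ℓ = 0` (conjecture (B) one order down — the induction hypothesis), one-sided children recursively.  The
inductive predicate **`Below n 𝒰 𝒱 ℓ`** ("`ℓ` is a chain-certified lower bound of the edge polynomial of `(𝒰,𝒱)` modulo (B) at two-sided pairs")
records exactly these certificates (`direct` | `twoSided` | `right` | `left`), and

**THEOREM (`bpos_mix_of_chainCert`, every order).**  Let `𝒰, 𝒱` be union-closed with `univ ∈ 𝒰 ∩ 𝒱` on `Fin (n+1)`.  Suppose every TWO-SIDED pulled-back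
pair `(comap f 𝒰, comap f 𝒱)` admits a CHAIN CERTIFICATE (`ChainCert`): `Below`-certified bounds `ℓ_{z,B}` for its good blocks (rooted at each `z`,
complement in some family) such that `cbarSlack + Σ_z Σ_{good B} (|B|−1)!·(1−β_B)·ℓ_{z,B}` is Bernstein-positive.  Then the edge polynomial
`w ↦ Φ_{n+1}(w·1_𝒰 + (1−w)·1_𝒱)` is `BPos (n+1)` — conjecture (B) for the pair.  The induction runs over two-sided nodes ONLY; one-sided restrictions
never appear as hypotheses.  With `ℓ = 0` at two-sided blocks, `ℓ = −N` (direct) at bad blocks and the recursive `right/left` certificates with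
single admissible roots at one-sided blocks this is the memo's (★′):
  `M_T ≥_B Σ_{bad Q⊊T} (k−|Q|)!·γ_{T∖Q}·N_Q + Σ_{descent chains through one-sided sets} ω·N_R`
(0 failures: all 374 715 pairs on 4 points; the 128 depth-≥3 one-sided pairs of 5 points inside 1 024 six-point pairs; > 10⁵ random/adversarial pairs on
5–8 points; 2-block-invariant pairs to 16 points — P4-GEN24-REPORT §4).
PROOF.  `bpos_sub_of_below`: a `Below` certificate of order `m < n` for a pulled-back pair is a valid lower bound (`BPos (P − ℓ)`) as soon as (B) holds
for the two-sided pulled-back pairs of order `< n` (induction on the certificate; the `right` step is `bpos_absorbed_step`, `left` is its mirror via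
`w ↦ 1−w`).  `bpos_mix_of_chainCert`: strong induction on `n`; `(n+1)·P_T = cbarSlack + goodPart` (`RootSummed.sum_roots_identity`), and
`goodPart − Σ (|B|−1)!(1−β_B)ℓ_{z,B} = Σ (|B|−1)!·(1−β_B)·(P_{T∖B} − ℓ_{z,B})` is Bernstein-positive block by block.
HONEST FRAMING: identities, a certificate format and a proved reduction; (★′), (C̄), (B), `UCHullNonneg k` (k ≥ 8), Sahi's `C_k` and the master
theorem remain OPEN.  Axioms standard. [this work]
-/

noncomputable section

open scoped Classical

namespace Summit.CriticalPhenomena.PercolationContinuityZ3.Theorems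

namespace ChainCert

open Finset Function Equiv
open Literature.Combinatorics.Sahi2008
open Literature.Combinatorics.Sahi2008.CycleForm
open PrincipalCapBeta (phiSet realF realW)
open BernsteinPos UCBernsteinNested RootSummed

variable {n : ℕ}

/-! ### Plumbing -/

/-- Subtraction of a smaller Bernstein-positive function keeps the difference's positivity bookkeeping: `BPos f → BPos (g − f) → BPos g`.
[this work] -/
theorem bpos_of_sub {d : ℕ} {f g : ℝ → ℝ} (hf : BPos d f) (hg : BPos d (fun w => g w - f w)) : BPos d g :=
  (hf.add hg).congr fun w => by ring

/-! ### The absorbed-root identity at a one-sided node -/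

/-- **Absorbed-root identity** (rooted coordinates): if no member of `𝒰` contains the last index, then
`Φ_{n+1}(mix 𝒰 𝒱 w) = (1−w)·[ W + Σ_{B ∋ last} (|B|−1)!·[B ∉ 𝒱]·(−κ_B) ]` — the top block carries no separate term. [this work] -/
theorem phiSet_mix_eq_absorbed (𝒰 𝒱 : Finset (Finset (Fin (n + 1)))) (havoid : ∀ S ∈ 𝒰, Fin.last n ∉ S) (w : ℝ) :
    phiSet (n + 1) (mix 𝒰 𝒱 w) = (1 - w) * (capW 𝒰 𝒱 w +
      ∑ B ∈ univ.filter (fun B : Finset (Fin (n + 1)) => Fin.last n ∈ B),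
        ((B.card - 1).factorial : ℝ) * ((if B ∈ 𝒱 then (0 : ℝ) else 1) * (-coRest (realW (mix 𝒰 𝒱 w)) realF B))) := by
  unfold capW
  rw [phiSet_eq_sum_blocks_last, ← sum_blocks_coRest_eq_W (mix 𝒰 𝒱 w), mul_add, mul_sum, mul_sum, ← sum_add_distrib]
  refine sum_congr rfl fun B hB => ?_
  have hlB : Fin.last n ∈ B := (mem_filter.1 hB).2
  have hBU : B ∉ 𝒰 := fun h => havoid B h hlB
  have e1 : mix 𝒰 𝒱 w B = (1 - w) * (if B ∈ 𝒱 then (1 : ℝ) else 0) := by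
    unfold mix; rw [if_neg hBU]; ring
  rw [e1]
  by_cases hBV : B ∈ 𝒱
  · rw [if_pos hBV, if_pos hBV]; ring
  · rw [if_neg hBV, if_neg hBV]; ring

/-- **Absorbed step with certified children.**  `univ ∈ 𝒱`, a root `z` in no member of `𝒰`; for every block `B ∋ last` (rooted coordinates) outside
`rooted z 𝒱` a function `ℓ_B` with `−κ_B − ℓ_B` Bernstein-positive ⇒ `P − (1−w)·Σ_B (|B|−1)!·ℓ_B` is `BPos (n+1)` (the cap term `W ≥_B 0` and the
certified differences are what is dropped). [this work] -/
theorem bpos_absorbed_step (𝒰 𝒱 : Finset (Finset (Fin (n + 1)))) (z : Fin (n + 1)) (hV : univ ∈ 𝒱) (hz : ∀ S ∈ 𝒰, z ∉ S)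
    (ℓ : Finset (Fin (n + 1)) → ℝ → ℝ)
    (hblocks : ∀ B : Finset (Fin (n + 1)), Fin.last n ∈ B → B ∉ rooted z 𝒱 →
      BPos n (fun w => -coRest (realW (mix (rooted z 𝒰) (rooted z 𝒱) w)) realF B - ℓ B w)) :
    BPos (n + 1) (fun w => phiSet (n + 1) (mix 𝒰 𝒱 w) -
      (1 - w) * ∑ B ∈ univ.filter (fun B : Finset (Fin (n + 1)) => Fin.last n ∈ B ∧ B ∉ rooted z 𝒱),
        ((B.card - 1).factorial : ℝ) * ℓ B w) := by
  have havoid : ∀ S ∈ rooted z 𝒰, Fin.last n ∉ S := by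
    unfold rooted; exact last_notMem_of_comap_swap z 𝒰 hz
  have hVr : univ ∈ rooted z 𝒱 := univ_mem_rooted hV
  -- the bracket: W + Σ_{B ∋ last} c_B · X_B with X_B = [B ∉ 𝒱''](−κ_B − ℓ_B)
  have hW := bpos_W' (k := n) (rooted z 𝒰) (rooted z 𝒱)
  have hX : BPos n (fun w => ∑ B ∈ univ.filter (fun B : Finset (Fin (n + 1)) => Fin.last n ∈ B),
      ((B.card - 1).factorial : ℝ) * (if B ∈ rooted z 𝒱 then (0 : ℝ) else
        (-coRest (realW (mix (rooted z 𝒰) (rooted z 𝒱) w)) realF B - ℓ B w))) := by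
    refine BPos.sum _ (fun B w => ((B.card - 1).factorial : ℝ) * (if B ∈ rooted z 𝒱 then (0 : ℝ) else
        (-coRest (realW (mix (rooted z 𝒰) (rooted z 𝒱) w)) realF B - ℓ B w))) fun B hB => ?_
    have hlB : Fin.last n ∈ B := (mem_filter.1 hB).2
    by_cases hBV : B ∈ rooted z 𝒱
    · exact bpos_zero.congr fun w => by rw [if_pos hBV, mul_zero]
    · exact ((hblocks B hlB hBV).smul (Nat.cast_nonneg _)).congr fun w => by rw [if_neg hBV]
  have hbr : BPos (n + 1) (fun w => (1 - w) * ((∑ σ : Perm (Fin n), ∏ B ∈ orbits σ,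
      (1 - mix (rooted z 𝒰) (rooted z 𝒱) w (B.map Fin.castSuccEmb))) +
      ∑ B ∈ univ.filter (fun B : Finset (Fin (n + 1)) => Fin.last n ∈ B),
        ((B.card - 1).factorial : ℝ) * (if B ∈ rooted z 𝒱 then (0 : ℝ) else
          (-coRest (realW (mix (rooted z 𝒰) (rooted z 𝒱) w)) realF B - ℓ B w)))) :=
    (bpos_one_sub.mul (hW.add hX)).mono (by omega)
  refine hbr.congr fun w => ?_
  have hsum : (∑ B ∈ univ.filter (fun B : Finset (Fin (n + 1)) => Fin.last n ∈ B ∧ B ∉ rooted z 𝒱),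
      ((B.card - 1).factorial : ℝ) * ℓ B w) =
      ∑ B ∈ univ.filter (fun B : Finset (Fin (n + 1)) => Fin.last n ∈ B),
        ((B.card - 1).factorial : ℝ) * ((if B ∈ rooted z 𝒱 then (0 : ℝ) else 1) * ℓ B w) := by
    rw [Finset.sum_filter, Finset.sum_filter]
    refine Finset.sum_congr rfl fun B _ => ?_
    by_cases h1 : Fin.last n ∈ B
    · by_cases h2 : B ∈ rooted z 𝒱
      · rw [if_neg (fun h => h.2 h2), if_pos h1, if_pos h2]; ring
      · rw [if_pos ⟨h1, h2⟩, if_pos h1, if_neg h2]; ring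
    · rw [if_neg (fun h => h1 h.1), if_neg h1]
  have hsum2 : (∑ B ∈ univ.filter (fun B : Finset (Fin (n + 1)) => Fin.last n ∈ B),
      ((B.card - 1).factorial : ℝ) * (if B ∈ rooted z 𝒱 then (0 : ℝ) else
        (-coRest (realW (mix (rooted z 𝒰) (rooted z 𝒱) w)) realF B - ℓ B w))) =
      (∑ B ∈ univ.filter (fun B : Finset (Fin (n + 1)) => Fin.last n ∈ B),
        ((B.card - 1).factorial : ℝ) * ((if B ∈ rooted z 𝒱 then (0 : ℝ) else 1) *
          (-coRest (realW (mix (rooted z 𝒰) (rooted z 𝒱) w)) realF B))) -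
      ∑ B ∈ univ.filter (fun B : Finset (Fin (n + 1)) => Fin.last n ∈ B),
        ((B.card - 1).factorial : ℝ) * ((if B ∈ rooted z 𝒱 then (0 : ℝ) else 1) * ℓ B w) := by
    rw [← Finset.sum_sub_distrib]
    refine Finset.sum_congr rfl fun B _ => ?_
    by_cases h2 : B ∈ rooted z 𝒱
    · rw [if_pos h2, if_pos h2]; ring
    · rw [if_neg h2, if_neg h2]; ring
  rw [hsum, ← phiSet_mix_rooted z 𝒰 𝒱 w, phiSet_mix_eq_absorbed (rooted z 𝒰) (rooted z 𝒱) havoid w, hsum2]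
  unfold capW
  ring

/-! ### Chain certificates -/

/-- **`Below n 𝒰 𝒱 ℓ`**: `ℓ` is a CHAIN-CERTIFIED LOWER BOUND of the edge polynomial of the pair `(𝒰,𝒱)` on `Fin (n+1)`, modulo conjecture (B) at
two-sided pairs: `direct` — `P − ℓ` is Bernstein-positive outright (e.g. `ℓ = P = −N` at a bad node); `twoSided` — `univ ∈ 𝒰 ∩ 𝒱` and `ℓ = 0`;
`right` — `univ ∈ 𝒱`, an admissible root `z` (in no member of `𝒰`), and for every block `B ∋ last` of the rooted pair outside `rooted z 𝒱` a
certificate for the pulled-back pair along EVERY enumeration of `univ ∖ B`, giving `ℓ = (1−w)·Σ_B (|B|−1)!·ℓ_B`; `left` — the mirror, `ℓ = w·Σ_B …`.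
[this work] -/
inductive Below : (n : ℕ) → Finset (Finset (Fin (n + 1))) → Finset (Finset (Fin (n + 1))) → (ℝ → ℝ) → Prop
  | direct {n : ℕ} {𝒰 𝒱 : Finset (Finset (Fin (n + 1)))} {ℓ : ℝ → ℝ}
      (h : BPos (n + 1) (fun w => phiSet (n + 1) (mix 𝒰 𝒱 w) - ℓ w)) : Below n 𝒰 𝒱 ℓ
  | twoSided {n : ℕ} {𝒰 𝒱 : Finset (Finset (Fin (n + 1)))} (hU : univ ∈ 𝒰) (hV : univ ∈ 𝒱) : Below n 𝒰 𝒱 (fun _ => 0)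
  | right {n : ℕ} {𝒰 𝒱 : Finset (Finset (Fin (n + 1)))} (z : Fin (n + 1)) (hV : univ ∈ 𝒱) (hz : ∀ S ∈ 𝒰, z ∉ S)
      (ℓB : Finset (Fin (n + 1)) → ℝ → ℝ)
      (h : ∀ B : Finset (Fin (n + 1)), Fin.last n ∈ B → B ∉ rooted z 𝒱 →
        ∀ (m : ℕ) (e : Fin (m + 1) ↪ Fin (n + 1)), (univ : Finset (Fin (m + 1))).map e = univ \ B →
          Below m (comap e (rooted z 𝒰)) (comap e (rooted z 𝒱)) (ℓB B)) :
      Below n 𝒰 𝒱 (fun w => (1 - w) * ∑ B ∈ univ.filter (fun B : Finset (Fin (n + 1)) => Fin.last n ∈ B ∧ B ∉ rooted z 𝒱),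
        ((B.card - 1).factorial : ℝ) * ℓB B w)
  | left {n : ℕ} {𝒰 𝒱 : Finset (Finset (Fin (n + 1)))} (z : Fin (n + 1)) (hU : univ ∈ 𝒰) (hz : ∀ S ∈ 𝒱, z ∉ S)
      (ℓB : Finset (Fin (n + 1)) → ℝ → ℝ)
      (h : ∀ B : Finset (Fin (n + 1)), Fin.last n ∈ B → B ∉ rooted z 𝒰 →
        ∀ (m : ℕ) (e : Fin (m + 1) ↪ Fin (n + 1)), (univ : Finset (Fin (m + 1))).map e = univ \ B →
          Below m (comap e (rooted z 𝒰)) (comap e (rooted z 𝒱)) (ℓB B)) :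
      Below n 𝒰 𝒱 (fun w => w * ∑ B ∈ univ.filter (fun B : Finset (Fin (n + 1)) => Fin.last n ∈ B ∧ B ∉ rooted z 𝒰),
        ((B.card - 1).factorial : ℝ) * ℓB B w)

/-- **A chain certificate is a valid lower bound**, given conjecture (B) for the two-sided pulled-back pairs below order `n`: if
`Below m (comap f 𝒰) (comap f 𝒱) ℓ` with `m < n` then `P − ℓ` is `BPos (m+1)`. [this work] -/
theorem bpos_sub_of_below (𝒰 𝒱 : Finset (Finset (Fin (n + 1))))
    (htwo : ∀ (m : ℕ) (f : Fin (m + 1) ↪ Fin (n + 1)), m < n → univ ∈ comap f 𝒰 → univ ∈ comap f 𝒱 →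
      BPos (m + 1) (fun w => phiSet (m + 1) (mix (comap f 𝒰) (comap f 𝒱) w)))
    {m : ℕ} {𝒰' 𝒱' : Finset (Finset (Fin (m + 1)))} {ℓ : ℝ → ℝ} (hb : Below m 𝒰' 𝒱' ℓ) :
    m < n → ∀ f : Fin (m + 1) ↪ Fin (n + 1), 𝒰' = comap f 𝒰 → 𝒱' = comap f 𝒱 →
      BPos (m + 1) (fun w => phiSet (m + 1) (mix 𝒰' 𝒱' w) - ℓ w) := by
  induction hb with
  | direct h => intro _ _ _ _; exact h
  | twoSided hU hV =>
    intro hm f hUf hVf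
    subst hUf; subst hVf
    exact (htwo _ f hm hU hV).congr fun w => by ring
  | @right m 𝒰' 𝒱' z hV hz ℓB h ih =>
    intro hm f hUf hVf
    refine bpos_absorbed_step 𝒰' 𝒱' z hV hz ℓB fun B hlB hBV => ?_
    have hBu : B ≠ univ := by rintro rfl; exact hBV (univ_mem_rooted hV)
    obtain ⟨m', e, he, hsurj, hc⟩ := exists_emb_coRest' hBu
    have hm' : m' < m := PhiVertex.lt_of_emb_ne_last e fun j hj => he j (by rw [hj]; exact hlB)
    have hrange : (univ : Finset (Fin (m' + 1))).map e = univ \ B := map_univ_eq_sdiff e he hsurj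
    have key := ih B hlB hBV m' e hrange (by omega) ((e.trans (Equiv.swap z (Fin.last m)).toEmbedding).trans f)
      (by subst hUf; unfold rooted; rw [comap_comap', comap_comap'])
      (by subst hVf; unfold rooted; rw [comap_comap', comap_comap'])
    refine (key.mono (by omega)).congr fun w => ?_
    rw [hc, mix_map, neg_neg]
  | @left m 𝒰' 𝒱' z hU hz ℓB h ih =>
    intro hm f hUf hVf
    -- mirror: apply the absorbed step to the swapped pair at `1 − w`, then reflect
    have hstep := bpos_absorbed_step 𝒱' 𝒰' z hU hz (fun B w => ℓB B (1 - w)) fun B hlB hBU => by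
      have hBu : B ≠ univ := by rintro rfl; exact hBU (univ_mem_rooted hU)
      obtain ⟨m', e, he, hsurj, hc⟩ := exists_emb_coRest' hBu
      have hm' : m' < m := PhiVertex.lt_of_emb_ne_last e fun j hj => he j (by rw [hj]; exact hlB)
      have hrange : (univ : Finset (Fin (m' + 1))).map e = univ \ B := map_univ_eq_sdiff e he hsurj
      have key := ih B hlB hBU m' e hrange (by omega) ((e.trans (Equiv.swap z (Fin.last m)).toEmbedding).trans f)
        (by subst hUf; unfold rooted; rw [comap_comap', comap_comap'])
        (by subst hVf; unfold rooted; rw [comap_comap', comap_comap'])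
      refine ((key.mono (by omega)).reflect).congr fun w => ?_
      rw [hc, mix_map, neg_neg, ← mix_swap (comap e (rooted z 𝒱')) (comap e (rooted z 𝒰')) w]
    refine hstep.reflect.congr fun w => ?_
    rw [mix_swap, sub_sub_cancel]

/-- **Chain certificate for a two-sided pair** (the hypothesis of the reduction; the memo's (★′) is the instance with single admissible roots,
`ℓ = 0` at two-sided blocks and exact values at bad blocks): certified bounds `ℓ z B` for the good blocks of every rooting such that
`cbarSlack + Σ_z Σ_{good B} (|B|−1)!·(1−β_B)·ℓ z B` is Bernstein-positive of degree `n+1`. [this work] -/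
def ChainCertAt (n : ℕ) (𝒰 𝒱 : Finset (Finset (Fin (n + 1)))) : Prop :=
  ∃ ℓ : Fin (n + 1) → Finset (Fin (n + 1)) → ℝ → ℝ,
    (∀ (z : Fin (n + 1)) (B : Finset (Fin (n + 1))), B ∈ goodBlocks (rooted z 𝒰) (rooted z 𝒱) →
      ∀ (m : ℕ) (e : Fin (m + 1) ↪ Fin (n + 1)), (univ : Finset (Fin (m + 1))).map e = univ \ B →
        Below m (comap e (rooted z 𝒰)) (comap e (rooted z 𝒱)) (ℓ z B)) ∧
    BPos (n + 1) (fun w => cbarSlack 𝒰 𝒱 w + ∑ z : Fin (n + 1), ∑ B ∈ goodBlocks (rooted z 𝒰) (rooted z 𝒱),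
      ((B.card - 1).factorial : ℝ) * ((1 - mix (rooted z 𝒰) (rooted z 𝒱) w B) * ℓ z B w))

/-- **THEOREM (chain criterion ⇒ (B), every order).**  For union-closed `𝒰, 𝒱 ∋ univ` on `Fin (n+1)`: if every two-sided pulled-back pair (including
the pair itself) admits a chain certificate, the edge polynomial of the pair is Bernstein-positive of degree `n+1` — conjecture (B) for the pair.  The
induction runs over two-sided nodes only. [this work] -/
theorem bpos_mix_of_chainCert : ∀ (n : ℕ) (𝒰 𝒱 : Finset (Finset (Fin (n + 1)))),
    (∀ A ∈ 𝒰, ∀ B ∈ 𝒰, A ∪ B ∈ 𝒰) → (∀ A ∈ 𝒱, ∀ B ∈ 𝒱, A ∪ B ∈ 𝒱) → univ ∈ 𝒰 → univ ∈ 𝒱 →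
    (∀ (m : ℕ) (f : Fin (m + 1) ↪ Fin (n + 1)), univ ∈ comap f 𝒰 → univ ∈ comap f 𝒱 → ChainCertAt m (comap f 𝒰) (comap f 𝒱)) →
    BPos (n + 1) (fun w => phiSet (n + 1) (mix 𝒰 𝒱 w)) := by
  intro n
  induction n using Nat.strong_induction_on with
  | _ n ih =>
  intro 𝒰 𝒱 hUC hVC hU hV hC
  -- (B) one order down for two-sided pulled-back pairs
  have htwo : ∀ (m : ℕ) (f : Fin (m + 1) ↪ Fin (n + 1)), m < n → univ ∈ comap f 𝒰 → univ ∈ comap f 𝒱 →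
      BPos (m + 1) (fun w => phiSet (m + 1) (mix (comap f 𝒰) (comap f 𝒱) w)) := by
    intro m f hm h1 h2
    refine ih m hm (comap f 𝒰) (comap f 𝒱) (comap_unionClosed f 𝒰 hUC) (comap_unionClosed f 𝒱 hVC) h1 h2 ?_
    intro m' f' h1' h2'
    rw [comap_comap'] at h1' h2'
    rw [comap_comap', comap_comap']
    exact hC m' _ h1' h2'
  -- the certificate of the pair itself
  obtain ⟨ℓ, hbelow, hpos⟩ : ChainCertAt n 𝒰 𝒱 := by
    have h := hC n (Equiv.refl (Fin (n + 1))).toEmbedding (by rw [comap_refl]; exact hU) (by rw [comap_refl]; exact hV)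
    rw [comap_refl, comap_refl] at h
    exact h
  -- the certified differences of the good blocks are Bernstein-positive
  have hdiff : BPos (n + 1) (fun w => goodPart 𝒰 𝒱 w - ∑ z : Fin (n + 1), ∑ B ∈ goodBlocks (rooted z 𝒰) (rooted z 𝒱),
      ((B.card - 1).factorial : ℝ) * ((1 - mix (rooted z 𝒰) (rooted z 𝒱) w B) * ℓ z B w)) := by
    have h : BPos (n + 1) (fun w => ∑ z : Fin (n + 1), ∑ B ∈ goodBlocks (rooted z 𝒰) (rooted z 𝒱),
        ((B.card - 1).factorial : ℝ) * ((1 - mix (rooted z 𝒰) (rooted z 𝒱) w B) *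
          (-coRest (realW (mix (rooted z 𝒰) (rooted z 𝒱) w)) realF B - ℓ z B w))) := by
      refine BPos.sum univ (fun z w => ∑ B ∈ goodBlocks (rooted z 𝒰) (rooted z 𝒱),
        ((B.card - 1).factorial : ℝ) * ((1 - mix (rooted z 𝒰) (rooted z 𝒱) w B) *
          (-coRest (realW (mix (rooted z 𝒰) (rooted z 𝒱) w)) realF B - ℓ z B w))) fun z _ => ?_
      refine BPos.sum _ (fun B w => ((B.card - 1).factorial : ℝ) * ((1 - mix (rooted z 𝒰) (rooted z 𝒱) w B) *
          (-coRest (realW (mix (rooted z 𝒰) (rooted z 𝒱) w)) realF B - ℓ z B w))) fun B hB => ?_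
      obtain ⟨hlB, hBu, _⟩ := (mem_filter.1 hB).2
      obtain ⟨m, e, he, hsurj, hc⟩ := exists_emb_coRest' hBu
      have hm : m < n := PhiVertex.lt_of_emb_ne_last e fun j hj => he j (by rw [hj]; exact hlB)
      have hrange : (univ : Finset (Fin (m + 1))).map e = univ \ B := map_univ_eq_sdiff e he hsurj
      have hb := hbelow z B hB m e hrange
      have key := bpos_sub_of_below 𝒰 𝒱 htwo hb hm (e.trans (Equiv.swap z (Fin.last n)).toEmbedding)
        (by unfold rooted; rw [comap_comap']) (by unfold rooted; rw [comap_comap'])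
      have hsub : BPos n (fun w => -coRest (realW (mix (rooted z 𝒰) (rooted z 𝒱) w)) realF B - ℓ z B w) := by
        refine (key.mono (by omega)).congr fun w => ?_
        rw [hc, mix_map, neg_neg]
      exact (((bpos_one_sub_mix' (rooted z 𝒰) (rooted z 𝒱) B).mul hsub).smul (Nat.cast_nonneg _)).mono (by omega)
    refine h.congr fun w => ?_
    unfold goodPart blockTerm
    rw [← Finset.sum_sub_distrib]
    refine Finset.sum_congr rfl fun z _ => ?_
    rw [← Finset.sum_sub_distrib]
    refine Finset.sum_congr rfl fun B _ => ?_
    ring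
  have hk : BPos (n + 1) (fun w => ((n : ℝ) + 1) * phiSet (n + 1) (mix 𝒰 𝒱 w)) :=
    (hpos.add hdiff).congr fun w => by rw [sum_roots_identity 𝒰 𝒱 hU hV w]; ring
  have hpos' : (0 : ℝ) ≤ 1 / ((n : ℝ) + 1) := by positivity
  refine (hk.smul hpos').congr fun w => ?_
  have hne : ((n : ℝ) + 1) ≠ 0 := by positivity
  field_simp

/-- Pointwise corollary: `(UC-hull)` on the edge `[1_𝒰, 1_𝒱]` under chain certificates at the two-sided restrictions. [this work] -/
theorem phiSet_mix_nonneg_of_chainCert (𝒰 𝒱 : Finset (Finset (Fin (n + 1))))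
    (hUC : ∀ A ∈ 𝒰, ∀ B ∈ 𝒰, A ∪ B ∈ 𝒰) (hVC : ∀ A ∈ 𝒱, ∀ B ∈ 𝒱, A ∪ B ∈ 𝒱) (hU : univ ∈ 𝒰) (hV : univ ∈ 𝒱)
    (hC : ∀ (m : ℕ) (f : Fin (m + 1) ↪ Fin (n + 1)), univ ∈ comap f 𝒰 → univ ∈ comap f 𝒱 → ChainCertAt m (comap f 𝒰) (comap f 𝒱))
    {w : ℝ} (hw0 : 0 ≤ w) (hw1 : w ≤ 1) : 0 ≤ phiSet (n + 1) (mix 𝒰 𝒱 w) :=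
  (bpos_mix_of_chainCert n 𝒰 𝒱 hUC hVC hU hV hC).nonneg hw0 hw1

/-- **The (C̄) skeleton is the special case with trivial certificates**: (C̄)-slack Bernstein-positive at a two-sided pair whose GOOD blocks all have
two-sided or directly certified complements gives a chain certificate with `ℓ = 0`.  In particular `ChainCertAt` holds whenever the (C̄) slack is
Bernstein-positive and every one-sided pulled-back pair has a Bernstein-positive edge polynomial (the hypotheses of `RootSummed.bpos_mix_of_cbar_of_oneSided`).
[this work] -/
theorem chainCertAt_of_cbar_of_oneSided (𝒰 𝒱 : Finset (Finset (Fin (n + 1))))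
    (hslack : BPos (n + 1) (cbarSlack 𝒰 𝒱))
    (hone : ∀ (m : ℕ) (e : Fin (m + 1) ↪ Fin (n + 1)), ¬(univ ∈ comap e 𝒰 ↔ univ ∈ comap e 𝒱) →
      BPos (m + 1) (fun w => phiSet (m + 1) (mix (comap e 𝒰) (comap e 𝒱) w))) :
    ChainCertAt n 𝒰 𝒱 := by
  refine ⟨fun _ _ _ => 0, fun z B hB m e he => ?_, hslack.congr fun w => by simp⟩
  obtain ⟨_, _, hgood⟩ := (mem_filter.1 hB).2
  have hmemU : univ ∈ comap e (rooted z 𝒰) ↔ univ \ B ∈ rooted z 𝒰 := by rw [mem_comap, he]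
  have hmemV : univ ∈ comap e (rooted z 𝒱) ↔ univ \ B ∈ rooted z 𝒱 := by rw [mem_comap, he]
  by_cases hU : univ \ B ∈ rooted z 𝒰
  · by_cases hV : univ \ B ∈ rooted z 𝒱
    · exact Below.twoSided (hmemU.2 hU) (hmemV.2 hV)
    · refine Below.direct ?_
      have h := hone m (e.trans (Equiv.swap z (Fin.last n)).toEmbedding) (by
        rw [← comap_comap', ← comap_comap']
        exact fun h => hV (hmemV.1 (h.1 (hmemU.2 hU))))
      rw [← comap_comap', ← comap_comap'] at h
      exact h.congr fun w => by unfold rooted; ring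
  · by_cases hV : univ \ B ∈ rooted z 𝒱
    · refine Below.direct ?_
      have h := hone m (e.trans (Equiv.swap z (Fin.last n)).toEmbedding) (by
        rw [← comap_comap', ← comap_comap']
        exact fun h => hU (hmemU.1 (h.2 (hmemV.2 hV))))
      rw [← comap_comap', ← comap_comap'] at h
      exact h.congr fun w => by unfold rooted; ring
    · exact absurd ⟨hU, hV⟩ hgood

end ChainCert

end Summit.CriticalPhenomena.PercolationContinuityZ3.Theorems
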